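import Summits.HubbardSuperconductivity.HubbardSuperconductivity.Theses.IsoperimetricCascade
import Summits.HubbardSuperconductivity.HubbardSuperconductivity.Theorems.BalabanIRBirEveryGroundStateStubLiebAnchor
import Summits.HubbardSuperconductivity.HubbardSuperconductivity.Theorems.ThermalWedgeTwSeededEnsembleEquivalenceBarrierEtaTower
import Literature.MathematicalPhysics.QuantumLattice.ApproximateEigenvectorLemmas

/-!
# Route `IsoperimetricCascade`, support `AttractiveSWaveOverlap` (item stmt-HubbardSuperconductivity-11988)

Card P3b, the solvable instance of `OverlapRate`'s logical type: for `U < 0`, every normalised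
`(2n, S^z = 0)`-sector ground state `ψ` of `hubbardTorus 2 L 1 U` satisfies
`‖(Δ_sᴴ)^n |0⟩‖² ≤ C(L², n) · ‖Δ_s^n ψ‖²`, `Δ_s = pairField sWave L = −√2 η` (`η = Σ_x c_{x↓} c_{x↑}`),
i.e. the fidelity of `ψ` with the flat `s`-wave antisymmetrised geminal power is `≥ 1/C(L², n)`.

Proof. `Φ := (Δ_sᴴ)^n |0⟩ = (−√2)^n n! Σ_{#S = n} |S↑ ∪ S↓⟩` (`etaRaise_pow_mulVec_vacuum`), so
`‖Φ‖² = 2^n (n!)² C(L², n)` and `⟨Φ, ψ⟩ = (−√2)^n n! Σ_S ψ(S↑ ∪ S↓)`; by Cauchy–Schwarz against the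
vacuum, `‖Δ_s^n ψ‖² ≥ |⟨Φ, ψ⟩|²`, and the claim reduces to `|Σ_S ψ(S↑ ∪ S↓)|² ≥ 1 = ‖ψ‖²`. In Lieb's
coefficient matrix `W_{αβ} = σ(α,β) ψ(α↑ ∪ β↓)` (a unitary transfer, `Σ|W_{αβ}|² = ‖ψ‖²`, with
`σ(α, α) = (−1)^{C(n,2)}` independent of `α`), spin-reflection positivity for `U < 0`
(`isLiebSystem_hubbard`, `IsLiebSystem.exists_posDef_eq_smul`) gives `W = c P` with `P` positive
definite, whence `|tr W|² = |c|² (tr P)² ≥ |c|² Σ|P_{αβ}|² = Σ|W_{αβ}|² = 1` (`2 × 2` principal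
minors of `P`). Lieb, PRL 62 (1989) 1201, Theorem 1 and its proof; Yang, PRL 63 (1989) 2144 (the
`η`-tower); Coleman, J. Math. Phys. 6 (1965) 1425 (antisymmetrised geminal powers). [folklore]
No definitions are introduced.
-/

-- the mandated namespace `Summit.<Summit>.<Problem>.Theorems` repeats `HubbardSuperconductivity`
-- (single-problem summit, D-0017), which the `dupNamespace` linter flags on every declaration
set_option linter.dupNamespace false

noncomputable section

namespace Summit.HubbardSuperconductivity.HubbardSuperconductivity.Theorems.IsoperimetricCascade

open Matrix Finset Literature.MathematicalPhysics.QuantumLattice Literature.Probability.LatticeModels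
open Summit.HubbardSuperconductivity.HubbardSuperconductivity.Theorems.TwSeededEnsembleEquivalence.ExposedDensity
  (etaTower_pairField_sWave_eq)
open scoped ComplexOrder

/-! ### Positive semidefinite matrices: `Σ |P_{ab}|² ≤ (tr P)²` -/

section PSD

variable {A : Type*} [Fintype A] [DecidableEq A]

omit [Fintype A] in
/-- `2 × 2` principal minors: `|P_{ab}|² ≤ P_{aa} P_{bb}` for a positive semidefinite `P`. [folklore] -/
theorem norm_sq_apply_le_of_posSemidef {P : Matrix A A ℂ} (hP : P.PosSemidef) (a b : A) :
    ‖P a b‖ ^ 2 ≤ (P a a).re * (P b b).re := by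
  have hherm := hP.1
  have hdiag : ∀ c, (P c c).im = 0 := fun c => by
    have h := congrFun (congrFun hherm c) c
    rw [conjTranspose_apply, Complex.star_def] at h
    exact Complex.conj_eq_iff_im.1 h
  by_cases hab : a = b
  · subst hab
    have : ‖P a a‖ = |(P a a).re| := by
      rw [← Complex.abs_re_eq_norm.2 (hdiag a)]
    rw [this, sq_abs, sq]
  · have h := (hP.submatrix ![a, b]).det_nonneg
    rw [det_fin_two] at h
    simp only [submatrix_apply, Matrix.cons_val_zero, Matrix.cons_val_one] at h
    have hba : P b a = star (P a b) := by
      have := congrFun (congrFun hherm b) a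
      rw [conjTranspose_apply] at this
      exact this.symm
    rw [hba] at h
    obtain ⟨hre, -⟩ := Complex.nonneg_iff.mp h
    rw [Complex.sub_re, Complex.mul_re, hdiag a, hdiag b, mul_zero, sub_zero, Complex.star_def,
      Complex.mul_conj, Complex.ofReal_re, Complex.normSq_eq_norm_sq] at hre
    linarith

/-- `Σ_{a,b} |P_{ab}|² ≤ (Σ_a P_{aa})²` for a positive semidefinite `P`. [folklore] -/
theorem sum_norm_sq_le_trace_sq_of_posSemidef {P : Matrix A A ℂ} (hP : P.PosSemidef) :
    ∑ a, ∑ b, ‖P a b‖ ^ 2 ≤ (∑ a, (P a a).re) ^ 2 := by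
  rw [sq (∑ a, (P a a).re), Finset.sum_mul_sum]
  exact Finset.sum_le_sum fun a _ => Finset.sum_le_sum fun b _ => norm_sq_apply_le_of_posSemidef hP a b

end PSD

/-! ### Lieb's sign on the diagonal and the trace of the coefficient matrix -/

section Signs

variable {Λ : Type*} [LinearOrder Λ] [Fintype Λ]

omit [Fintype Λ] in
/-- **The pair sign on the diagonal is a constant**: `σ(α, α) = (−1)^{C(#α, 2)}`. [folklore] -/
theorem pairSign_self (α : Finset Λ) : pairSign α α = (-1 : ℂ) ^ (α.card.choose 2) := by
  induction α using Finset.induction_on_max with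
  | empty => simp [pairSign]
  | insert x γ hx ih =>
    have hxγ : x ∉ γ := fun h => lt_irrefl x (hx x h)
    rw [pairSign, prod_insert hxγ]
    -- the new factor: every element of `γ` lies below `x`
    have h1 : jwSign x (insert x γ) = (-1 : ℂ) ^ γ.card := by
      rw [jwSign, filter_insert, if_neg (lt_irrefl x)]
      congr 2
      exact (Finset.filter_true_of_mem fun y hy => hx y hy)
    -- the old factors are unchanged
    have h2 : ∀ a ∈ γ, jwSign a (insert x γ) = jwSign a γ := fun a ha =>
      jwSign_insert_of_not_lt (not_lt.mpr (hx a ha).le)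
    rw [h1, Finset.prod_congr rfl h2, ← pairSign, ih, card_insert_of_notMem hxγ, ← pow_add,
      Nat.choose_succ_succ', Nat.choose_one_right, add_comm]

omit [LinearOrder Λ] in
/-- Sums over Lieb's configurations `Config Λ n = {S // #S = n}` are sums over `powersetCard n`.
[folklore] -/
theorem sum_config_eq_sum_powersetCard {β : Type*} [AddCommMonoid β] (n : ℕ) (f : Finset Λ → β) :
    ∑ α : Config Λ n, f α.1 = ∑ S ∈ powersetCard n (univ : Finset Λ), f S := by
  have h : ∀ S : Finset Λ, S ∈ powersetCard n (univ : Finset Λ) ↔ S.card = n := fun S => by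
    simp [mem_powersetCard]
  rw [Finset.sum_subtype (powersetCard n (univ : Finset Λ)) h f]

/-- The trace of Lieb's coefficient matrix: `tr W = (−1)^{C(n,2)} Σ_{#S = n} ψ(S↑ ∪ S↓)`. [folklore] -/
theorem sum_liebW_diag (n : ℕ) (ψ : Fock (Orb Λ)) :
    ∑ α : Config Λ n, liebW n ψ α α =
      (-1 : ℂ) ^ (n.choose 2) * ∑ S ∈ powersetCard n (univ : Finset Λ), ψ (pairSet S S) := by
  rw [← sum_config_eq_sum_powersetCard n (fun S => ψ (pairSet S S)), Finset.mul_sum]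
  refine Finset.sum_congr rfl fun α _ => ?_
  rw [liebW_apply, pairSign_self, α.2]

end Signs

/-! ### Matrix powers as iterates (free of the `DecidableEq` instance behind `M ^ k`) -/

section Iterate

variable {m : Type*} [Fintype m]

/-- `M ^ k v = (M ·)^{∘k} v`. [folklore] -/
theorem pow_mulVec_eq_iterate [DecidableEq m] (M : Matrix m m ℂ) (v : m → ℂ) (k : ℕ) :
    M ^ k *ᵥ v = (M.mulVec)^[k] v := by
  induction k with
  | zero => rw [pow_zero, one_mulVec, Function.iterate_zero, id]
  | succ k ih => rw [pow_succ', ← mulVec_mulVec, ih, Function.iterate_succ_apply']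

/-- `((c • M) ·)^{∘k} v = c^k • (M ·)^{∘k} v`. [folklore] -/
theorem iterate_smul_mulVec (c : ℂ) (M : Matrix m m ℂ) (v : m → ℂ) (k : ℕ) :
    ((c • M).mulVec)^[k] v = c ^ k • (M.mulVec)^[k] v := by
  induction k with
  | zero => simp
  | succ k ih =>
    rw [Function.iterate_succ_apply', ih, Function.iterate_succ_apply', smul_mulVec, mulVec_smul,
      smul_smul, pow_succ']

end Iterate

/-! ### The flat antisymmetrised geminal power `(Δ_sᴴ)^n |0⟩` -/

section AGP

variable {Λ : Type*} [LinearOrder Λ] [Fintype Λ]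

/-- `S↑ ∪ S↓ = pairSet S S` contains exactly the orbitals over `S`. [folklore] -/
theorem mem_pairSet_self (S : Finset Λ) (i : Orb Λ) : i ∈ pairSet S S ↔ (ofLex i).1 ∈ S := by
  rw [mem_pairSet]
  constructor
  · rintro (⟨-, h⟩ | ⟨-, h⟩) <;> exact h
  · intro h
    rcases Fin.exists_fin_two.mp ⟨(ofLex i).2, rfl⟩ with h0 | h1
    · exact Or.inl ⟨h0, h⟩
    · exact Or.inr ⟨h1, h⟩

/-- `S ↦ S↑ ∪ S↓` is injective. [folklore] -/
theorem pairSet_self_injective : Function.Injective fun S : Finset Λ => pairSet S S := by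
  intro S T h
  ext x
  have h1 := mem_pairSet_self S (orb x 0)
  have h2 := mem_pairSet_self T (orb x 0)
  simp only at h
  rw [h] at h1
  simpa using h1.symm.trans h2

/-- **The `η`-tower with all signs `+1`**: `(η†)^n |0⟩ = n! Σ_{#S = n} |S↑ ∪ S↓⟩`. [folklore] -/
theorem etaRaise_one_pow_mulVec_vacuum (n : ℕ) :
    etaRaise (fun _ : Λ => (1 : ℤˣ)) ^ n *ᵥ (vacuum : Fock (Orb Λ)) =
      (n.factorial : ℂ) • ∑ S ∈ powersetCard n (univ : Finset Λ), Pi.single (pairSet S S) (1 : ℂ) := by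
  have h := etaRaise_pow_mulVec_vacuum (P := fun S : Finset Λ => pairSet S S) mem_pairSet_self
    (fun _ : Λ => (1 : ℤˣ)) n
  simp only [Units.val_one, Int.cast_one, Finset.prod_const_one, one_smul] at h
  exact h

/-- The same, with the power written as an iterate. [folklore] -/
theorem iterate_etaRaise_one_mulVec_vacuum (n : ℕ) :
    ((etaRaise (fun _ : Λ => (1 : ℤˣ))).mulVec)^[n] (vacuum : Fock (Orb Λ)) =
      (n.factorial : ℂ) • ∑ S ∈ powersetCard n (univ : Finset Λ), Pi.single (pairSet S S) (1 : ℂ) := by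
  rw [← pow_mulVec_eq_iterate]
  exact etaRaise_one_pow_mulVec_vacuum n

/-- The overlap of the flat geminal sum with a Fock vector: `⟨Σ_S |S↑∪S↓⟩, ψ⟩ = Σ_S ψ(S↑ ∪ S↓)`.
[folklore] -/
theorem star_sum_single_pairSet_dotProduct (n : ℕ) (ψ : Fock (Orb Λ)) :
    star (∑ S ∈ powersetCard n (univ : Finset Λ), Pi.single (pairSet S S) (1 : ℂ)) ⬝ᵥ ψ =
      ∑ S ∈ powersetCard n (univ : Finset Λ), ψ (pairSet S S) := by
  rw [star_sum, sum_dotProduct]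
  refine Finset.sum_congr rfl fun S _ => ?_
  rw [← Pi.single_star, star_one, single_dotProduct, one_mul]

/-- The squared norm of the flat geminal sum: `‖Σ_{#S=n} |S↑∪S↓⟩‖² = C(|Λ|, n)`. [folklore] -/
theorem star_sum_single_pairSet_dotProduct_self (n : ℕ) :
    star (∑ S ∈ powersetCard n (univ : Finset Λ), Pi.single (pairSet S S) (1 : ℂ)) ⬝ᵥ
        (∑ S ∈ powersetCard n (univ : Finset Λ), Pi.single (pairSet S S) (1 : ℂ)) =
      ((Fintype.card Λ).choose n : ℂ) := by
  rw [star_sum_single_pairSet_dotProduct]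
  have h : ∀ S ∈ powersetCard n (univ : Finset Λ),
      (∑ T ∈ powersetCard n (univ : Finset Λ), (Pi.single (pairSet T T) (1 : ℂ) : Fock (Orb Λ)))
        (pairSet S S) = 1 := by
    intro S hS
    rw [Finset.sum_apply, Finset.sum_eq_single S]
    · simp
    · intro T _ hTS
      rw [Pi.single_apply, if_neg (fun h => hTS (pairSet_self_injective h).symm)]
    · exact fun h => absurd hS h
  rw [Finset.sum_congr rfl h, Finset.sum_const, Finset.card_powersetCard, Finset.card_univ]
  simp

end AGP

/-! ### The overlap bound -/

/-- **`AttractiveSWaveOverlap`** (route `IsoperimetricCascade`, item stmt-HubbardSuperconductivity-11988):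
for `U < 0` every normalised `(2n, 0)`-sector ground state `ψ` of `hubbardTorus 2 L 1 U` has
`‖(Δ_sᴴ)^n|0⟩‖² ≤ C(L², n) ‖Δ_s^n ψ‖²`. [cite: LiebPRL1989, Theorem 1] -/
theorem attractiveSWaveOverlap_proof :
    Summit.HubbardSuperconductivity.HubbardSuperconductivity.Theses.IsoperimetricCascade.AttractiveSWaveOverlap := by
  intro U hU L _ n ψ hψ1 hGS
  dsimp only
  set Δ := pairField sWave L with hΔ
  set c : ℂ := -((Real.sqrt 2 : ℝ) : ℂ) with hc
  -- `Δ = c η`, `Δᴴ = c η†`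
  have hΔη : Δ = c • etaLower (fun _ : FermionTorus 2 L => (1 : ℤˣ)) := etaTower_pairField_sWave_eq L
  have hΔc : Δᴴ = c • etaRaise (fun _ : FermionTorus 2 L => (1 : ℤˣ)) := by
    rw [hΔη, conjTranspose_smul, etaLower, conjTranspose_conjTranspose]
    congr 1
    rw [hc, Complex.star_def, map_neg, Complex.conj_ofReal]
  -- `Φ := (Δᴴ)^n |0⟩ = (c^n n!) • Ψ`, `Ψ = Σ_{#S = n} |S↑ ∪ S↓⟩`
  have hΨΨ := star_sum_single_pairSet_dotProduct_self (Λ := FermionTorus 2 L) n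
  have hΨψ := star_sum_single_pairSet_dotProduct (Λ := FermionTorus 2 L) n ψ
  have h1 : Δᴴ ^ n *ᵥ (vacuum : Fock (Orb (FermionTorus 2 L))) =
      c ^ n • ((etaRaise (fun _ : FermionTorus 2 L => (1 : ℤˣ))).mulVec)^[n] vacuum := by
    rw [pow_mulVec_eq_iterate, hΔc, iterate_smul_mulVec]
  have hΦ := h1.trans (congrArg (fun w => c ^ n • w) (iterate_etaRaise_one_mulVec_vacuum n))
  simp only [smul_smul] at hΦ
  -- Cauchy–Schwarz against the vacuum: `‖Δ^n ψ‖² ≥ |⟨Φ, ψ⟩|²`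
  have hvac1 : star (vacuum : Fock (Orb (FermionTorus 2 L))) ⬝ᵥ vacuum = 1 := by
    simp [vacuum]
  have hCS : ‖star (Δᴴ ^ n *ᵥ vacuum) ⬝ᵥ ψ‖ ^ 2 ≤ (star (Δ ^ n *ᵥ ψ) ⬝ᵥ (Δ ^ n *ᵥ ψ)).re := by
    have hmove : star (Δᴴ ^ n *ᵥ (vacuum : Fock (Orb (FermionTorus 2 L)))) ⬝ᵥ ψ =
        star vacuum ⬝ᵥ (Δ ^ n *ᵥ ψ) := by
      rw [star_mulVec, ← dotProduct_mulVec, conjTranspose_pow, conjTranspose_conjTranspose]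
    rw [hmove, ← eucNorm_sq]
    have h := norm_star_dotProduct_le_eucNorm hvac1 (Δ ^ n *ᵥ ψ)
    exact pow_le_pow_left₀ (norm_nonneg _) h 2
  -- the heart: `|Σ_S ψ(S↑∪S↓)|² ≥ 1`
  have hkey : 1 ≤ ‖∑ S ∈ powersetCard n (univ : Finset (FermionTorus 2 L)), ψ (pairSet S S)‖ ^ 2 := by
    -- `ψ` in Lieb's `(n, n)` sector, eigenvector at the sector energy
    obtain ⟨hψK, hψ0, hψeig⟩ := hGS
    have hsec : IsInSector n n ψ := (mem_szSector_two_mul_zero_iff n ψ).1 hψK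
    set H := hubbardTorus 2 L 1 U with hH
    set E := H.minEnergyOn (szSector (2 * n) 0) with hE
    have hn : n ≤ Fintype.card (FermionTorus 2 L) := by
      by_contra hlt
      rw [not_le] at hlt
      -- a sector vector needs `n` up-electrons on distinct sites
      apply hψ0
      funext s
      by_cases hs : (upPart s).card = n ∧ (downPart s).card = n
      · exfalso
        have := Finset.card_le_univ (upPart s)
        omega
      · exact hsec s hs
    have hEv : ∀ φ : Fock (Orb (FermionTorus 2 L)), IsInSector n n φ →
        E * (star φ ⬝ᵥ φ).re ≤ (expect H φ).re :=
      (szSector_groundState (fermionTorusGraph 2 L) 1 U hn).2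
    have hLS := LiebThm1.isLiebSystem_hubbard (fermionTorusGraph 2 L) (fermionTorusGraph_connected 2 L)
      one_ne_zero hU n hEv
    set W := liebW n ψ with hW
    have hWeig : liebOp (liebK (fermionTorusGraph 2 L) 1 n) (liebL n) U W = (E : ℂ) • W := by
      rw [hW, ← LiebThm1.liebW_hamiltonian_mulVec, show hamiltonian (fermionTorusGraph 2 L) 1 U = H from rfl,
        hψeig, liebW_smul]
    have hW0 : W ≠ 0 := fun h => hψ0 ((LiebThm1.liebW_eq_zero_iff hsec).1 h)
    obtain ⟨P, hP, -, c', hWcP⟩ := hLS.exists_posDef_eq_smul hWeig hW0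
    -- `Σ |W_{αβ}|² = ‖ψ‖² = 1`
    have hnorm : ∑ α, ∑ β, ‖W α β‖ ^ 2 = 1 := by
      rw [← hsInner_self_re, hW, LiebThm1.hsInner_liebW hsec, hψ1, Complex.one_re]
    -- `Σ |W_{αβ}|² = |c'|² Σ |P_{αβ}|² ≤ |c'|² (tr P)² = |tr W|²`
    have hPdiag : ∀ α, (P α α).im = 0 := fun α => by
      have h := congrFun (congrFun hP.1 α) α
      rw [conjTranspose_apply, Complex.star_def] at h
      exact Complex.conj_eq_iff_im.1 h
    have htrW : ∑ α, W α α = c' * ∑ α, P α α := by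
      rw [hWcP, Finset.mul_sum]
      rfl
    have htrP : (∑ α, P α α) = ((∑ α, (P α α).re : ℝ) : ℂ) := by
      rw [Complex.ofReal_sum]
      refine Finset.sum_congr rfl fun α _ => ?_
      apply Complex.ext
      · simp
      · simp [hPdiag α]
    have hle : ∑ α, ∑ β, ‖W α β‖ ^ 2 ≤ ‖∑ α, W α α‖ ^ 2 := by
      calc ∑ α, ∑ β, ‖W α β‖ ^ 2 = ‖c'‖ ^ 2 * ∑ α, ∑ β, ‖P α β‖ ^ 2 := by
            rw [hWcP, Finset.mul_sum]
            refine Finset.sum_congr rfl fun α _ => ?_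
            rw [Finset.mul_sum]
            refine Finset.sum_congr rfl fun β _ => ?_
            rw [Matrix.smul_apply, smul_eq_mul, norm_mul, mul_pow]
        _ ≤ ‖c'‖ ^ 2 * (∑ α, (P α α).re) ^ 2 :=
            mul_le_mul_of_nonneg_left (sum_norm_sq_le_trace_sq_of_posSemidef hP.posSemidef) (sq_nonneg _)
        _ = ‖∑ α, W α α‖ ^ 2 := by
            rw [htrW, htrP, norm_mul, mul_pow, Complex.norm_real, Real.norm_eq_abs, sq_abs]
    rw [hnorm, sum_liebW_diag, norm_mul, mul_pow, norm_pow, norm_neg, norm_one, one_pow, one_pow,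
      one_mul] at hle
    exact hle
  -- assemble: `‖Φ‖² = |b|² C(L², n)` (`b = c^n n!`), `⟨Φ, ψ⟩ = b̄ Σ_S ψ(S↑∪S↓)`
  have hcard : Fintype.card (FermionTorus 2 L) = L ^ 2 := card_fermionTorus 2 L
  rw [hcard] at hΨΨ
  set b : ℂ := c ^ n * (n.factorial : ℂ) with hb
  have hΦnorm : (star (Δᴴ ^ n *ᵥ (vacuum : Fock (Orb (FermionTorus 2 L)))) ⬝ᵥ (Δᴴ ^ n *ᵥ vacuum)).re =
      ‖b‖ ^ 2 * ((L ^ 2).choose n : ℝ) := by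
    rw [hΦ, star_smul, smul_dotProduct, dotProduct_smul, smul_smul, hΨΨ, smul_eq_mul, Complex.star_def,
      Complex.conj_mul', ← Complex.ofReal_pow, ← Complex.ofReal_natCast, ← Complex.ofReal_mul,
      Complex.ofReal_re]
  have hΦψ : star (Δᴴ ^ n *ᵥ (vacuum : Fock (Orb (FermionTorus 2 L)))) ⬝ᵥ ψ =
      star b * ∑ S ∈ powersetCard n (univ : Finset (FermionTorus 2 L)), ψ (pairSet S S) := by
    rw [hΦ, star_smul, smul_dotProduct, hΨψ, smul_eq_mul]
  rw [hΦnorm]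
  have hC0 : (0 : ℝ) ≤ ((L ^ 2).choose n : ℝ) := Nat.cast_nonneg _
  calc ‖b‖ ^ 2 * ((L ^ 2).choose n : ℝ)
      ≤ ((L ^ 2).choose n : ℝ) * (‖b‖ ^ 2 *
          ‖∑ S ∈ powersetCard n (univ : Finset (FermionTorus 2 L)), ψ (pairSet S S)‖ ^ 2) := by
        nlinarith [hkey, sq_nonneg ‖b‖, hC0, mul_nonneg (sq_nonneg ‖b‖) hC0]
    _ = ((L ^ 2).choose n : ℝ) * ‖star (Δᴴ ^ n *ᵥ vacuum) ⬝ᵥ ψ‖ ^ 2 := by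
        rw [hΦψ, norm_mul (star b), norm_star, mul_pow]
    _ ≤ ((L ^ 2).choose n : ℝ) * (star (Δ ^ n *ᵥ ψ) ⬝ᵥ (Δ ^ n *ᵥ ψ)).re :=
        mul_le_mul_of_nonneg_left hCS hC0

end Summit.HubbardSuperconductivity.HubbardSuperconductivity.Theorems.IsoperimetricCascade

end
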